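import Literature.NumberTheory.GaloisRepresentations.ContinuousH1
import HarnessLib

/-!
# The cup product `H¹ × H¹ → H²` on continuous cohomology

For a locally compact topological group `G`, topological representations `X`, `Y`, `Z` over a
commutative ring `R` (Mathlib `TopRep R G`) and a continuous `R`-bilinear `G`-equivariant pairing
`⟨ , ⟩ : X × Y → Z` (`ContPairing X Y Z`), this file constructs the **cup product**

  `ContPairing.cupProduct : H¹_cont(G, X) →ₗ[R] H¹_cont(G, Y) →ₗ[R] H²_cont(G, Z)`

on Mathlib's continuous cohomology (`continuousCohomology`, homology of the complex of
`G`-invariant homogeneous continuous cochains `C(G, C(G, ⋯ C(G, X)))`), in the bidegree `(1, 1)`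
needed for local Tate duality, by the Alexander–Whitney formula on homogeneous cochains,

  `(F₁ ∪ F₂)(x, y, z) = ⟨F₁(x, y), F₂(y, z)⟩`

(Neukirch–Schmidt–Wingberg, *Cohomology of Number Fields*, I §4, (1.4.1) ff.: the cup product on
homogeneous cochains of pro-finite groups, `(a ∪ b)(σ₀, …, σ_{p+q}) = a(σ₀, …, σ_p) ⊗ b(σ_p, …,
σ_{p+q})`, followed by the pairing; Cartan–Eilenberg for abstract groups; for continuous cochains
of topological groups the same formula is used, e.g. Tate, *Relations between `K₂` and Galois
cohomology* (1976), §2).  Degree-`1` classes are represented by continuous crossed homomorphisms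
`f : G → X` (`Literature.NumberTheory.GaloisRepresentations.oneCocycleClass_surjective`, file
`ContinuousH1.lean`), whose homogeneous cochain is `F(x, y) = f(y) - f(x)`; so on crossed
homomorphisms the cup product is the continuous homogeneous `2`-cocycle

  `(f ∪ g)(x, y, z) = ⟨f(y) - f(x), g(z) - g(y)⟩`            (`ContPairing.cupTwoCochain`),

whose inhomogeneous form is the familiar `(σ, τ) ↦ ⟨f(σ), σ g(τ)⟩`.

## Main definitions and results

* `ContPairing X Y Z` — continuous `R`-bilinear `G`-equivariant pairings; `ContPairing.ofDiscrete`
  (continuity is automatic for discrete `X`, `Y`); `ContPairing.restrict` along `θ : H →ₜ* G`.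
* `ContPairing.cupTwoCochain`, `ContPairing.d_cupTwoCochain` — the invariant homogeneous
  `2`-cochain `f ∪ g` and `d(f ∪ g) = 0` (pure bilinearity).
* `ContPairing.cupClass f g ∈ H²_cont(G, Z)` — its class; bi-additive and `R`-bilinear
  (`cupClass_add_left/right`, `cupClass_smul_left/right`), and zero when `f` or `g` is a
  principal crossed homomorphism (`cupClass_eq_zero_of_left/right`: `f ∪ g = d H` with
  `H(x, y) = ⟨x v, g(y) - g(x)⟩`, resp. `H(x, y) = ⟨f(x) - f(y), y w⟩`).
* `ContPairing.cupProduct` — the induced `R`-bilinear map on cohomology, characterised by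
  `cupProduct [f] [g] = cupClass f g` (`cupProduct_oneCocycleClass`).

Graded-commutativity, associativity, other bidegrees and compatibility with connecting
homomorphisms are not treated here.

## References

* J. Neukirch, A. Schmidt, K. Wingberg, *Cohomology of Number Fields*, 2nd ed. (2008), I §4
  (cup products on homogeneous cochains). [NeukirchSchmidtWingberg2008]
* J. Tate, *Relations between K₂ and Galois cohomology*, Invent. Math. 36 (1976), §2 (continuous
  cochain cohomology and its cup products).
* J.-P. Serre, *Cohomologie galoisienne* (5e éd.) / *Galois Cohomology* (1997), I §2.2.
  [SerreGaloisCohomology1997]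
-/

noncomputable section

open CategoryTheory Limits Function

universe u v

namespace Literature.NumberTheory.GaloisRepresentations

open TopRep ContRepresentation ContinuousCohomology

set_option allowUnsafeReducibility true in
attribute [local reducible] CategoryTheory.Functor.mapHomologicalComplex

/-! ### Homogeneous cochains in degrees two and three -/

section Cochains

variable {R : Type u} [Ring R] [TopologicalSpace R]
variable {G : Type v} [Group G] [TopologicalSpace G] [IsTopologicalGroup G]
variable (X : TopRep.{v} R G)

/-- The third differential of Mathlib's standard resolution:
`(d F)(x)(y)(z)(w) = F y z w - (F x z w - (F x y w - F x y z))`. [folklore] -/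
theorem d_three_hom_apply (F : C(G, C(G, C(G, X)))) (x y z w : G) :
    (TopRep.d X 3).hom F x y z w = F y z w - (F x z w - (F x y w - F x y z)) := rfl

/-- The action of `G` on `2`-cochains `C(G, C(G, C(G, X)))` (the iterated coinduced action):
`(g · F)(x, y, z) = g · F(g⁻¹x, g⁻¹y, g⁻¹z)`. [folklore] -/
theorem resolutionX_three_ρ_apply (g : G) (F : C(G, C(G, C(G, X)))) (x y z : G) :
    ((resolutionX X 3).ρ g F : C(G, C(G, C(G, X)))) x y z =
      X.ρ g (F (g⁻¹ * x) (g⁻¹ * y) (g⁻¹ * z)) := rfl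

/-- The action of `G` on `1`-cochains `C(G, C(G, X))`: `(g · F)(x, y) = g · F(g⁻¹x, g⁻¹y)`.
[folklore] -/
theorem resolutionX_two_ρ_apply (g : G) (F : C(G, C(G, X))) (x y : G) :
    ((resolutionX X 2).ρ g F : C(G, C(G, X))) x y = X.ρ g (F (g⁻¹ * x) (g⁻¹ * y)) := rfl

/-- `(ComplexShape.up ℕ).next 2 = 3`. [folklore] -/
theorem up_nat_next_two : (ComplexShape.up ℕ).next 2 = 3 := CochainComplex.next ℕ 2

/-- `(ComplexShape.up ℕ).prev 2 = 1`. [folklore] -/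
theorem up_nat_prev_two : (ComplexShape.up ℕ).prev 2 = 1 := CochainComplex.prev_nat_succ 1

variable [LocallyCompactSpace G]

omit [IsTopologicalGroup G] in
/-- A continuous function of three variables as a nested continuous map (currying twice; `G`
locally compact). [folklore] -/
def nest₃ (Φ : C(G × G × G, X)) : C(G, C(G, C(G, X))) :=
  (⟨ContinuousMap.curry, ContinuousMap.continuous_curry⟩ : C(C(G × G, X), C(G, C(G, X)))).comp
    Φ.curry

omit [IsTopologicalGroup G] in
/-- Unfolding `nest₃`. [folklore] -/
@[simp] theorem nest₃_apply (Φ : C(G × G × G, X)) (x y z : G) : nest₃ X Φ x y z = Φ (x, y, z) :=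
  rfl

end Cochains

/-! ### Continuous equivariant pairings -/

section Pairing

variable {R : Type u} [CommRing R] [TopologicalSpace R]
variable {G : Type v} [Group G] [TopologicalSpace G]

/-- A **continuous `G`-equivariant `R`-bilinear pairing** `⟨ , ⟩ : X × Y → Z` of topological
representations: `⟨g x, g y⟩ = g ⟨x, y⟩`.  (E.g. the evaluation `M × Hom(M, μₙ) → μₙ` of local Tate
duality, or multiplication `K̄ˣ ⊗ ℤ → K̄ˣ`.)
Ref: Neukirch–Schmidt–Wingberg, *Cohomology of Number Fields* (2008), I §4 (pairings
`A × B → C` of `G`-modules and their cup products). [folklore] -/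
structure ContPairing (X Y Z : TopRep.{v} R G) where
  /-- The underlying bilinear map. -/
  toLin : X →ₗ[R] Y →ₗ[R] Z
  /-- Joint continuity. -/
  continuous_toLin : Continuous fun p : X × Y => toLin p.1 p.2
  /-- `G`-equivariance: `⟨g x, g y⟩ = g ⟨x, y⟩`. -/
  toLin_smul (g : G) (x : X) (y : Y) : toLin (X.ρ g x) (Y.ρ g y) = Z.ρ g (toLin x y)

namespace ContPairing

variable {X Y Z : TopRep.{v} R G}

/-- A `G`-equivariant bilinear pairing of representations on **discrete** modules is a continuous
pairing. [folklore] -/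
def ofDiscrete [DiscreteTopology X] [DiscreteTopology Y] (B : X →ₗ[R] Y →ₗ[R] Z)
    (hB : ∀ (g : G) (x : X) (y : Y), B (X.ρ g x) (Y.ρ g y) = Z.ρ g (B x y)) : ContPairing X Y Z where
  toLin := B
  continuous_toLin := continuous_of_discreteTopology
  toLin_smul := hB

omit [TopologicalSpace G] in
/-- Unfolding `ofDiscrete`. [folklore] -/
@[simp] theorem ofDiscrete_toLin [DiscreteTopology X] [DiscreteTopology Y] (B : X →ₗ[R] Y →ₗ[R] Z)
    (hB : ∀ (g : G) (x : X) (y : Y), B (X.ρ g x) (Y.ρ g y) = Z.ρ g (B x y)) :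
    (ofDiscrete B hB).toLin = B := rfl

/-- Restriction of a pairing along a continuous homomorphism `θ : H → G` (same bilinear map, the
groups acting through `θ`; Mathlib `TopRep.res`). [folklore] -/
def restrict {H : Type v} [Group H] [TopologicalSpace H] (θ : H →ₜ* G) (φ : ContPairing X Y Z) :
    ContPairing (TopRep.res (θ : H →* G) X) (TopRep.res (θ : H →* G) Y)
      (TopRep.res (θ : H →* G) Z) where
  toLin := φ.toLin
  continuous_toLin := φ.continuous_toLin
  toLin_smul h x y := φ.toLin_smul (θ h) x y

/-- Unfolding `restrict`. [folklore] -/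
@[simp] theorem restrict_toLin {H : Type v} [Group H] [TopologicalSpace H] (θ : H →ₜ* G)
    (φ : ContPairing X Y Z) : (φ.restrict θ).toLin = φ.toLin := rfl

end ContPairing

end Pairing

/-! ### The cup product of two crossed homomorphisms -/

namespace ContPairing

variable {R : Type u} [CommRing R] [TopologicalSpace R]
variable {G : Type v} [Group G] [TopologicalSpace G] [IsTopologicalGroup G] [LocallyCompactSpace G]
variable {X Y Z : TopRep.{v} R G} (φ : ContPairing X Y Z)

/-- The function `(x, y, z) ↦ ⟨f y - f x, g z - g y⟩` of the cup product of two continuous maps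
`f : G → X`, `g : G → Y`, as a continuous map on `G × G × G`. [folklore] -/
def cupFun₃ (f : C(G, X)) (g : C(G, Y)) : C(G × G × G, Z) where
  toFun p := φ.toLin (f p.2.1 - f p.1) (g p.2.2 - g p.2.1)
  continuous_toFun :=
    φ.continuous_toLin.comp
      (((f.continuous.comp (continuous_fst.comp continuous_snd)).sub
          (f.continuous.comp continuous_fst)).prodMk
        ((g.continuous.comp (continuous_snd.comp continuous_snd)).sub
          (g.continuous.comp (continuous_fst.comp continuous_snd))))

omit [IsTopologicalGroup G] [LocallyCompactSpace G] in
/-- Unfolding `cupFun₃`. [folklore] -/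
@[simp] theorem cupFun₃_apply (f : C(G, X)) (g : C(G, Y)) (x y z : G) :
    φ.cupFun₃ f g (x, y, z) = φ.toLin (f y - f x) (g z - g y) := rfl

/-- **The cup product of two continuous crossed homomorphisms** `f : G → X`, `g : G → Y`, the
homogeneous `2`-cochain `(x, y, z) ↦ ⟨f y - f x, g z - g y⟩` with values in `Z`, is `G`-invariant
(the Alexander–Whitney product `F₁ ∪ F₂ (x, y, z) = ⟨F₁(x, y), F₂(y, z)⟩` of the homogeneous
`1`-cocycles `F₁ = (x, y) ↦ f y - f x`, `F₂` of `f`, `g`; invariance from `x · f(x⁻¹y) = f y - f x`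
and the equivariance of the pairing).
Ref: Neukirch–Schmidt–Wingberg, *Cohomology of Number Fields* (2008), I §4. [folklore] -/
theorem cupFun₃_mem_invariants (f : contOneCocycles X) (g : contOneCocycles Y) :
    nest₃ Z (φ.cupFun₃ f.1 g.1) ∈ (resolutionX Z 3).ρ.invariants := by
  rw [ContRepresentation.mem_invariants]
  intro s
  refine ContinuousMap.ext fun x => ContinuousMap.ext fun y => ContinuousMap.ext fun z => ?_
  rw [resolutionX_three_ρ_apply, nest₃_apply, nest₃_apply, cupFun₃_apply, cupFun₃_apply,
    ← φ.toLin_smul, map_sub (X.ρ s), map_sub (Y.ρ s), contOneCocycles.apply_smul_inv_mul,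
    contOneCocycles.apply_smul_inv_mul, contOneCocycles.apply_smul_inv_mul,
    contOneCocycles.apply_smul_inv_mul, sub_sub_sub_cancel_right, sub_sub_sub_cancel_right]

/-- The cup product of two continuous crossed homomorphisms as an invariant homogeneous
`2`-cochain (see `cupFun₃_mem_invariants`). [folklore] -/
def cupTwoCochain (f : contOneCocycles X) (g : contOneCocycles Y) : (homogeneousCochains Z).X 2 :=
  ⟨nest₃ Z (φ.cupFun₃ f.1 g.1), φ.cupFun₃_mem_invariants f g⟩

/-- Unfolding `cupTwoCochain` on elements. [folklore] -/
@[simp] theorem cupTwoCochain_apply (f : contOneCocycles X) (g : contOneCocycles Y) (x y z : G) :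
    ((φ.cupTwoCochain f g : (homogeneousCochains Z).X 2) : C(G, C(G, C(G, Z)))) x y z =
      φ.toLin (f.1 y - f.1 x) (g.1 z - g.1 y) := rfl

/-- **`d (f ∪ g) = 0`**: the cup product of two crossed homomorphisms is a `2`-cocycle (the
alternating sum `∑ (-1)ⁱ ⟨f x_{i'} - f x_i, …⟩` vanishes by bilinearity alone). [folklore] -/
theorem d_cupTwoCochain (f : contOneCocycles X) (g : contOneCocycles Y) :
    (homogeneousCochains Z).d 2 3 (φ.cupTwoCochain f g) = 0 := by
  apply Subtype.ext
  have h := homogeneousCochains.d_apply Z 2 (φ.cupTwoCochain f g)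
  change (((homogeneousCochains Z).d 2 3 (φ.cupTwoCochain f g) : (homogeneousCochains Z).X 3) :
    C(G, C(G, C(G, C(G, Z))))) = (d Z 3).hom (nest₃ Z (φ.cupFun₃ f.1 g.1)) at h
  rw [h]
  ext x y z w
  rw [d_three_hom_apply, nest₃_apply, nest₃_apply, nest₃_apply, nest₃_apply, cupFun₃_apply,
    cupFun₃_apply, cupFun₃_apply, cupFun₃_apply]
  change _ = (0 : Z)
  simp only [map_sub, LinearMap.sub_apply]
  abel

/-- The class **`[f ∪ g] ∈ H²_cont(G, Z)`** of the cup product of two continuous crossed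
homomorphisms. [folklore] -/
def cupClass (f : contOneCocycles X) (g : contOneCocycles Y) : continuousCohomology 2 Z :=
  cxClass (homogeneousCochains Z) 2 3 up_nat_next_two (φ.cupTwoCochain f g) (φ.d_cupTwoCochain f g)

/-- `(f + f') ∪ g = f ∪ g + f' ∪ g` on cochains. [folklore] -/
theorem cupTwoCochain_add_left (f f' : contOneCocycles X) (g : contOneCocycles Y) :
    φ.cupTwoCochain (f + f') g = φ.cupTwoCochain f g + φ.cupTwoCochain f' g := by
  refine Subtype.ext (ContinuousMap.ext fun x => ContinuousMap.ext fun y =>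
    ContinuousMap.ext fun z => ?_)
  change φ.toLin ((f.1 + f'.1) y - (f.1 + f'.1) x) (g.1 z - g.1 y) =
    φ.toLin (f.1 y - f.1 x) (g.1 z - g.1 y) + φ.toLin (f'.1 y - f'.1 x) (g.1 z - g.1 y)
  rw [ContinuousMap.add_apply, ContinuousMap.add_apply, add_sub_add_comm, LinearMap.map_add₂]

/-- `f ∪ (g + g') = f ∪ g + f ∪ g'` on cochains. [folklore] -/
theorem cupTwoCochain_add_right (f : contOneCocycles X) (g g' : contOneCocycles Y) :
    φ.cupTwoCochain f (g + g') = φ.cupTwoCochain f g + φ.cupTwoCochain f g' := by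
  refine Subtype.ext (ContinuousMap.ext fun x => ContinuousMap.ext fun y =>
    ContinuousMap.ext fun z => ?_)
  change φ.toLin (f.1 y - f.1 x) ((g.1 + g'.1) z - (g.1 + g'.1) y) =
    φ.toLin (f.1 y - f.1 x) (g.1 z - g.1 y) + φ.toLin (f.1 y - f.1 x) (g'.1 z - g'.1 y)
  rw [ContinuousMap.add_apply, ContinuousMap.add_apply, add_sub_add_comm, map_add]

/-- `(r f) ∪ g = r (f ∪ g)` on cochains. [folklore] -/
theorem cupTwoCochain_smul_left (r : R) (f : contOneCocycles X) (g : contOneCocycles Y) :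
    φ.cupTwoCochain (r • f) g = r • φ.cupTwoCochain f g := by
  refine Subtype.ext (ContinuousMap.ext fun x => ContinuousMap.ext fun y =>
    ContinuousMap.ext fun z => ?_)
  change φ.toLin ((r • f.1) y - (r • f.1) x) (g.1 z - g.1 y) =
    r • φ.toLin (f.1 y - f.1 x) (g.1 z - g.1 y)
  rw [ContinuousMap.smul_apply, ContinuousMap.smul_apply, ← smul_sub, LinearMap.map_smul₂]

/-- `f ∪ (r g) = r (f ∪ g)` on cochains. [folklore] -/
theorem cupTwoCochain_smul_right (r : R) (f : contOneCocycles X) (g : contOneCocycles Y) :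
    φ.cupTwoCochain f (r • g) = r • φ.cupTwoCochain f g := by
  refine Subtype.ext (ContinuousMap.ext fun x => ContinuousMap.ext fun y =>
    ContinuousMap.ext fun z => ?_)
  change φ.toLin (f.1 y - f.1 x) ((r • g.1) z - (r • g.1) y) =
    r • φ.toLin (f.1 y - f.1 x) (g.1 z - g.1 y)
  rw [ContinuousMap.smul_apply, ContinuousMap.smul_apply, ← smul_sub, LinearMap.map_smul]

/-- Additivity of `[f ∪ g]` in `f`. [folklore] -/
theorem cupClass_add_left (f f' : contOneCocycles X) (g : contOneCocycles Y) :
    φ.cupClass (f + f') g = φ.cupClass f g + φ.cupClass f' g := by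
  unfold cupClass
  rw [← cxClass_add]
  exact cxClass_congr (φ.cupTwoCochain_add_left f f' g)

/-- Additivity of `[f ∪ g]` in `g`. [folklore] -/
theorem cupClass_add_right (f : contOneCocycles X) (g g' : contOneCocycles Y) :
    φ.cupClass f (g + g') = φ.cupClass f g + φ.cupClass f g' := by
  unfold cupClass
  rw [← cxClass_add]
  exact cxClass_congr (φ.cupTwoCochain_add_right f g g')

/-- Homogeneity of `[f ∪ g]` in `f`. [folklore] -/
theorem cupClass_smul_left (r : R) (f : contOneCocycles X) (g : contOneCocycles Y) :
    φ.cupClass (r • f) g = r • φ.cupClass f g := by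
  unfold cupClass
  rw [← cxClass_smul]
  exact cxClass_congr (φ.cupTwoCochain_smul_left r f g)

/-- Homogeneity of `[f ∪ g]` in `g`. [folklore] -/
theorem cupClass_smul_right (r : R) (f : contOneCocycles X) (g : contOneCocycles Y) :
    φ.cupClass f (r • g) = r • φ.cupClass f g := by
  unfold cupClass
  rw [← cxClass_smul]
  exact cxClass_congr (φ.cupTwoCochain_smul_right r f g)

/-- `[f ∪ g]` is subtractive in `f`. [folklore] -/
theorem cupClass_sub_left (f f' : contOneCocycles X) (g : contOneCocycles Y) :
    φ.cupClass (f - f') g = φ.cupClass f g - φ.cupClass f' g := by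
  rw [eq_sub_iff_add_eq, ← cupClass_add_left, sub_add_cancel]

/-- `[f ∪ g]` is subtractive in `g`. [folklore] -/
theorem cupClass_sub_right (f : contOneCocycles X) (g g' : contOneCocycles Y) :
    φ.cupClass f (g - g') = φ.cupClass f g - φ.cupClass f g' := by
  rw [eq_sub_iff_add_eq, ← cupClass_add_right, sub_add_cancel]

/-- An invariant homogeneous `1`-cochain from a continuous function of two variables satisfying
the invariance identity. [folklore] -/
def oneCochainOfFun (H : C(G × G, Z)) (hH : ∀ (s x y : G), Z.ρ s (H (s⁻¹ * x, s⁻¹ * y)) = H (x, y)) :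
    (homogeneousCochains Z).X 1 :=
  ⟨H.curry, by
    rw [ContRepresentation.mem_invariants]
    intro s
    refine ContinuousMap.ext fun x => ContinuousMap.ext fun y => ?_
    rw [resolutionX_two_ρ_apply, ContinuousMap.curry_apply, ContinuousMap.curry_apply, hH]⟩

omit [LocallyCompactSpace G] in
/-- Unfolding `oneCochainOfFun`. [folklore] -/
@[simp] theorem oneCochainOfFun_apply (H : C(G × G, Z))
    (hH : ∀ (s x y : G), Z.ρ s (H (s⁻¹ * x, s⁻¹ * y)) = H (x, y)) (x y : G) :
    ((oneCochainOfFun H hH : (homogeneousCochains Z).X 1) : C(G, C(G, Z))) x y = H (x, y) := rfl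

omit [LocallyCompactSpace G] in
/-- The differential of an invariant `1`-cochain, on elements:
`(dH)(x, y, z) = H(y, z) - (H(x, z) - H(x, y))`. [folklore] -/
theorem d_one_two_apply (τ : (homogeneousCochains Z).X 1) (x y z : G) :
    (((homogeneousCochains Z).d 1 2 τ : (homogeneousCochains Z).X 2) : C(G, C(G, C(G, Z)))) x y z =
      (τ : C(G, C(G, Z))) y z - ((τ : C(G, C(G, Z))) x z - (τ : C(G, C(G, Z))) x y) := by
  have h := homogeneousCochains.d_apply Z 1 τ
  change (((homogeneousCochains Z).d 1 2 τ : (homogeneousCochains Z).X 2) :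
    C(G, C(G, C(G, Z)))) = (d Z 2).hom τ.1 at h
  rw [h]
  rfl

/-- **`f ∪ g` is a coboundary if `f` is principal**: for `f(x) = x v - v`,
`f ∪ g = d H` with `H(x, y) = ⟨x v, g y - g x⟩`. [folklore] -/
theorem cupClass_eq_zero_of_left (f : contOneCocycles X) (g : contOneCocycles Y)
    (hf : oneCocycleClass X f = 0) : φ.cupClass f g = 0 := by
  obtain ⟨v, hv⟩ := (oneCocycleClass_eq_zero_iff X f).1 hf
  unfold cupClass
  rw [cxClass_eq_zero_iff _ 2 3 up_nat_next_two 1 up_nat_prev_two]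
  -- `x v = f x + v`, continuous in `x`
  have hxv : ∀ x, X.ρ x v = f.1 x + v := fun x => by rw [hv x, sub_add_cancel]
  let H : C(G × G, Z) :=
    ⟨fun p => φ.toLin (f.1 p.1 + v) (g.1 p.2 - g.1 p.1),
      φ.continuous_toLin.comp (((f.1.continuous.comp continuous_fst).add continuous_const).prodMk
        ((g.1.continuous.comp continuous_snd).sub (g.1.continuous.comp continuous_fst)))⟩
  have hH : ∀ x y, H (x, y) = φ.toLin (f.1 x + v) (g.1 y - g.1 x) := fun _ _ => rfl
  have hHinv : ∀ (s x y : G), Z.ρ s (H (s⁻¹ * x, s⁻¹ * y)) = H (x, y) := by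
    intro s x y
    rw [hH, hH, ← φ.toLin_smul, map_sub, contOneCocycles.apply_smul_inv_mul,
      contOneCocycles.apply_smul_inv_mul, sub_sub_sub_cancel_right, ← hxv,
      ← ContinuousLinearMap.comp_apply, ← ContinuousLinearMap.mul_def, ← map_mul,
      mul_inv_cancel_left, hxv]
  refine ⟨oneCochainOfFun H hHinv, Subtype.ext ?_⟩
  refine ContinuousMap.ext fun x => ContinuousMap.ext fun y => ContinuousMap.ext fun z => ?_
  rw [d_one_two_apply, oneCochainOfFun_apply, oneCochainOfFun_apply, oneCochainOfFun_apply,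
    cupTwoCochain_apply, hH, hH, hH]
  simp only [map_sub, map_add, LinearMap.sub_apply, LinearMap.add_apply]
  abel

/-- **`f ∪ g` is a coboundary if `g` is principal**: for `g(y) = y w - w`,
`f ∪ g = d H` with `H(x, y) = ⟨f x - f y, y w⟩`. [folklore] -/
theorem cupClass_eq_zero_of_right (f : contOneCocycles X) (g : contOneCocycles Y)
    (hg : oneCocycleClass Y g = 0) : φ.cupClass f g = 0 := by
  obtain ⟨w, hw⟩ := (oneCocycleClass_eq_zero_iff Y g).1 hg
  unfold cupClass
  rw [cxClass_eq_zero_iff _ 2 3 up_nat_next_two 1 up_nat_prev_two]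
  have hyw : ∀ y, Y.ρ y w = g.1 y + w := fun y => by rw [hw y, sub_add_cancel]
  let H : C(G × G, Z) :=
    ⟨fun p => φ.toLin (f.1 p.1 - f.1 p.2) (g.1 p.2 + w),
      φ.continuous_toLin.comp (((f.1.continuous.comp continuous_fst).sub
        (f.1.continuous.comp continuous_snd)).prodMk
        ((g.1.continuous.comp continuous_snd).add continuous_const))⟩
  have hH : ∀ x y, H (x, y) = φ.toLin (f.1 x - f.1 y) (g.1 y + w) := fun _ _ => rfl
  have hHinv : ∀ (s x y : G), Z.ρ s (H (s⁻¹ * x, s⁻¹ * y)) = H (x, y) := by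
    intro s x y
    rw [hH, hH, ← φ.toLin_smul, map_sub, contOneCocycles.apply_smul_inv_mul,
      contOneCocycles.apply_smul_inv_mul, sub_sub_sub_cancel_right, ← hyw,
      ← ContinuousLinearMap.comp_apply, ← ContinuousLinearMap.mul_def, ← map_mul,
      mul_inv_cancel_left, hyw]
  refine ⟨oneCochainOfFun H hHinv, Subtype.ext ?_⟩
  refine ContinuousMap.ext fun x => ContinuousMap.ext fun y => ContinuousMap.ext fun z => ?_
  rw [d_one_two_apply, oneCochainOfFun_apply, oneCochainOfFun_apply, oneCochainOfFun_apply,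
    cupTwoCochain_apply, hH, hH, hH]
  simp only [map_sub, map_add, LinearMap.sub_apply]
  abel

/-- `[f ∪ g]` depends only on the class of `f`. [folklore] -/
theorem cupClass_congr_left {f f' : contOneCocycles X} (g : contOneCocycles Y)
    (h : oneCocycleClass X f = oneCocycleClass X f') : φ.cupClass f g = φ.cupClass f' g := by
  have h0 : oneCocycleClass X (f - f') = 0 := by rw [oneCocycleClass_sub, h, sub_self]
  have h1 := φ.cupClass_eq_zero_of_left (f - f') g h0
  rwa [cupClass_sub_left, sub_eq_zero] at h1

/-- `[f ∪ g]` depends only on the class of `g`. [folklore] -/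
theorem cupClass_congr_right (f : contOneCocycles X) {g g' : contOneCocycles Y}
    (h : oneCocycleClass Y g = oneCocycleClass Y g') : φ.cupClass f g = φ.cupClass f g' := by
  have h0 : oneCocycleClass Y (g - g') = 0 := by rw [oneCocycleClass_sub, h, sub_self]
  have h1 := φ.cupClass_eq_zero_of_right f (g - g') h0
  rwa [cupClass_sub_right, sub_eq_zero] at h1

/-- `[f ∪ g]` computed on chosen representatives of the classes of `f` and `g`. [folklore] -/
theorem cupClass_surjInv (f : contOneCocycles X) (g : contOneCocycles Y) :
    φ.cupClass (surjInv (oneCocycleClass_surjective X) (oneCocycleClass X f))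
        (surjInv (oneCocycleClass_surjective Y) (oneCocycleClass Y g)) = φ.cupClass f g :=
  (φ.cupClass_congr_left _ (surjInv_eq (oneCocycleClass_surjective X) _)).trans
    (φ.cupClass_congr_right _ (surjInv_eq (oneCocycleClass_surjective Y) _))

/-- **The cup product `H¹_cont(G, X) × H¹_cont(G, Y) → H²_cont(G, Z)`** attached to a continuous
equivariant pairing `X × Y → Z`: the `R`-bilinear map induced by `(f, g) ↦ [f ∪ g]` on continuous
crossed homomorphisms (well defined by `cupClass_eq_zero_of_left/right`; every class is the class
of a crossed homomorphism, `oneCocycleClass_surjective`).  Characterised by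
`cupProduct_oneCocycleClass`.
Ref: Neukirch–Schmidt–Wingberg, *Cohomology of Number Fields* (2008), I §4 (cup product on
homogeneous cochains, bidegree `(1, 1)`); Tate (1976), §2. [cite: NeukirchSchmidtWingberg2008, I §4] -/
def cupProduct :
    continuousCohomology 1 X →ₗ[R] continuousCohomology 1 Y →ₗ[R] continuousCohomology 2 Z :=
  LinearMap.mk₂ R
    (fun a b => φ.cupClass (surjInv (oneCocycleClass_surjective X) a)
      (surjInv (oneCocycleClass_surjective Y) b))
    (fun a a' b => by
      obtain ⟨f, rfl⟩ := oneCocycleClass_surjective X a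
      obtain ⟨f', rfl⟩ := oneCocycleClass_surjective X a'
      obtain ⟨g, rfl⟩ := oneCocycleClass_surjective Y b
      rw [← oneCocycleClass_add, cupClass_surjInv, cupClass_surjInv, cupClass_surjInv,
        cupClass_add_left])
    (fun r a b => by
      obtain ⟨f, rfl⟩ := oneCocycleClass_surjective X a
      obtain ⟨g, rfl⟩ := oneCocycleClass_surjective Y b
      rw [← oneCocycleClass_smul, cupClass_surjInv, cupClass_surjInv, cupClass_smul_left])
    (fun a b b' => by
      obtain ⟨f, rfl⟩ := oneCocycleClass_surjective X a
      obtain ⟨g, rfl⟩ := oneCocycleClass_surjective Y b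
      obtain ⟨g', rfl⟩ := oneCocycleClass_surjective Y b'
      rw [← oneCocycleClass_add, cupClass_surjInv, cupClass_surjInv, cupClass_surjInv,
        cupClass_add_right])
    (fun r a b => by
      obtain ⟨f, rfl⟩ := oneCocycleClass_surjective X a
      obtain ⟨g, rfl⟩ := oneCocycleClass_surjective Y b
      rw [← oneCocycleClass_smul, cupClass_surjInv, cupClass_surjInv, cupClass_smul_right])

/-- **`[f] ∪ [g] = [f ∪ g]`**: the cup product of the classes of two continuous crossed
homomorphisms is the class of the `2`-cocycle `(x, y, z) ↦ ⟨f y - f x, g z - g y⟩`. [folklore] -/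
@[simp] theorem cupProduct_oneCocycleClass (f : contOneCocycles X) (g : contOneCocycles Y) :
    φ.cupProduct (oneCocycleClass X f) (oneCocycleClass Y g) = φ.cupClass f g := by
  rw [cupProduct, LinearMap.mk₂_apply, cupClass_surjInv]

end ContPairing

end Literature.NumberTheory.GaloisRepresentations

end
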